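import Summits.ValiantsHypothesis.ValiantsHypothesis.Theorems.FifoMatchingNNDivisionHardExactPencilColumnHit
import HarnessLib

/-!
# EXACT PENCILS XIII — ★★★ THE WINDOW CLOSED FROM ABOVE (`cor_add_sparseCube_decided_window`, `cor_add_sparseDiff_decided_window`: NINE's kernel threshold `s = n / (2(log₂ n + c)^c + 6)`, every `n`, no `n₀`) and C′ IN ITS LITERAL LAW-BODY CURRENCY (`lawBody_bound_of_commonMaxD`, `exactTilted_lawBody_of_edgesReadD`, `exactTilted_lawBody_funcGraph`) (crux `NNDivisionHard`, stmt-ValiantsHypothesis-21181) — `ExactPencil` port part 13/13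

Theorems-side port (staged by val-idea-40 g6, C′-census owner per director-valiant R331 (2)(e) / R334 (2) / desk #399, for the port hands;
press as `Theorems/FifoMatchingNNDivisionHardExactPencilWindow.lean`, `--kind proof --supports stmt-ValiantsHypothesis-21181 --as helper`; sig-first val-idea-crit-9 g3) of
the SEVEN declarations ADDED in val-idea-38 g2's crux workfile `Cruxes/NNDivisionHard/ExactPencil38.lean` REV 17 @ad493c466fcd / REV 18 @b2086f926775
(sha16 9a46dd74f359ce98, 3 489 l., FINAL from 38 g2, bus 01:30:05Z «g2-21 (FINAL)»; both revs ADDITIVE over REV 16 @4e81d1716f6b = the source of parts 1–12: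
279/279 common statement texts identical, 7 new).  Declaration texts VERBATIM from REV 18 (namespace `…Theorems.FifoMatching.ExactPencil`), in their source
section contexts (`SparseRate`; `DeadBlocks`, `PairsRead`, `FuncGraph` with `variable {n k : ℕ}`).  NOTE: REV 17 also re-proved `cor_add_bound_of_commonMaxD`
THROUGH `lawBody_bound_of_commonMaxD`; part 10 keeps that theorem's REV 16 proof (same statement), so here the law-body engine simply lands AFTER it — no
statement differs.  Part 13/13 of the port (imports part 12, `…Theorems.FifoMatchingNNDivisionHardExactPencilColumnHit`).

* §12a′ ★ `T_succ_mul_two_pow_lt` (`2(log₂ n + c)^c + 6 ≤ k ⟹ (T c n + 1)·2^k < 3^k`, EVERY `n`), ★ `T_lt_of_block_uniform`,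
  ★★★ `cor_add_sparseCube_decided_window` (affine cubes with generator column supports `< s`, `s·(2(log₂ n + c)^c + 6) ≤ n` ⟹ `T c n < r`; R334 (2) prover half);
* §12c′ ★★ `lawBody_bound_of_commonMaxD` (mechanism α's engine in the literal law-body currency of `exactTilted`: maxima `mm` attained + a nonnegative
  factorization of the augmented slack through `Option (Fin r)` ⟹ `3^{k−|D|} ≤ (r+1)·2^{k−|D|}`), ★★★ `exactTilted_lawBody_of_edgesReadD` (cone-certified edge-read passengers);
* §12e′ ★★★ `cor_add_sparseDiff_decided_window` (pairwise-difference column supports `< s`, same window, any passenger);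
* §12h′ ★★★ `exactTilted_lawBody_funcGraph` (`exactTilted.Law`'s body on function-graph passengers: `PM(K_n)`, Birkhoff vertices, maps).

CURRENCY (crit-9 g3 V#100 / desk #408–#410, director ruling pending): val-idea-41 g4's `ExactPencilLaw ↔ CorVirtualHardN` is a PAPER PASS (kernel file
`ExactIsVirtual41.lean` pending) — if it lands, the law-body forms here are the EXACT-PENCIL FORM of COR-VIRTUAL on the same species (proof-route note, not a
second level).  HONEST LABEL: every theorem here is a DECIDED SPECIES / rate lemma for the OPEN law C′ = `LocatedRows.ExactPencilLaw` (`exactTilted.Law`);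
the crux 21181 `NNDivisionHard`, C′, `allRows.Law` and COR-VIRTUAL are OPEN; C⁺_entry `LocatedPencilLaw` is REFUTED (✓ p679540).  VP ≠ VNP is NOT
proved here or anywhere in this tree.
-/

set_option autoImplicit false

-- the mandated summit-side namespace repeats a component by design (single-problem summit)
set_option linter.dupNamespace false

noncomputable section

open Matrix Finset
open scoped Pointwise

namespace Summit.ValiantsHypothesis.ValiantsHypothesis.Theorems.FifoMatching.ExactPencil

open Literature.Barriers.PneNP (HasEFOfSize three_pow_le_card_mul_two_pow_of_cover_univ)
open Literature.Combinatorics.Optimization.FixedSizePsdRank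
  (corPolytope flat vecOuter flat_dotProduct_le_of_mem_corPolytope flat_dotProduct_vecOuter)
open Summit.ValiantsHypothesis.ValiantsHypothesis.Theorems.FifoMatching.XcDivision
  (udRow udPt udInd udMat ud_data udInd_apply udInd_sq dot_le_of_mem_convexHull flat_dotProduct_flat)
open Summit.ValiantsHypothesis.ValiantsHypothesis.Theorems.FifoMatching.LocatedRows
  (T CorVirtualHardN RowFamily corVirtualHardN_of_law flat_le_box entryTilted allRows LocatedPencilLaw
    hCOR le_hCOR exists_eq_hCOR flat_le_hCOR hCOR_le_box exactTilted ExactPencilLaw exactTilted_emb_allRows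
    corVirtualHardN_of_exactPencilLaw three_pow_le_of_block two_pow_half_mul_le pinnedRows unflat flat_unflat
    pinnedRows_emb_exactTilted corVirtualHardN_of_pinnedRowsLaw zgen cubePt dotProduct_cubePt)

/-! ### §12a′ the UNIFORM RATE and the WINDOW for sparse-generator cubes (REV 18 ll. 2713–2752, `section SparseRate`) -/

section SparseRate

/-- ★ UNIFORM RATE (the window closed from above, R334 (2)): `2·(log₂ n + c)^c + 6 ≤ k ⟹ (T c n + 1)·2^k < 3^k`, for EVERY `n`. -/
theorem T_succ_mul_two_pow_lt (c n k : ℕ) (hk : 2 * (Nat.log 2 n + c) ^ c + 6 ≤ k) : (T c n + 1) * 2 ^ k < 3 ^ k := by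
  obtain ⟨j, rfl⟩ := Nat.exists_eq_add_of_le hk
  have hM : ∀ M : ℕ, (2 ^ M + 1) * 2 ^ (2 * M + 6) < 3 ^ (2 * M + 6) := by
    intro M
    have h8 : (8 : ℕ) ^ M ≤ 9 ^ M := Nat.pow_le_pow_left (by norm_num) M
    have h4 : (4 : ℕ) ^ M ≤ 9 ^ M := Nat.pow_le_pow_left (by norm_num) M
    have e2 : (2 : ℕ) ^ (2 * M + 6) = 64 * 4 ^ M := by rw [pow_add, pow_mul]; norm_num; ring
    have e3 : (3 : ℕ) ^ (2 * M + 6) = 729 * 9 ^ M := by rw [pow_add, pow_mul]; norm_num; ring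
    have e8 : (2 : ℕ) ^ M * 4 ^ M = 8 ^ M := by rw [← mul_pow]; norm_num
    have h9 : 0 < (9 : ℕ) ^ M := by positivity
    rw [e2, e3]
    calc (2 ^ M + 1) * (64 * 4 ^ M) = 64 * (2 ^ M * 4 ^ M) + 64 * 4 ^ M := by ring
      _ = 64 * 8 ^ M + 64 * 4 ^ M := by rw [e8]
      _ ≤ 64 * 9 ^ M + 64 * 9 ^ M := add_le_add (Nat.mul_le_mul_left _ h8) (Nat.mul_le_mul_left _ h4)
      _ < 729 * 9 ^ M := by linarith
  have h1 := hM ((Nat.log 2 n + c) ^ c)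
  have h3 : (2 : ℕ) ^ j ≤ 3 ^ j := Nat.pow_le_pow_left (by norm_num) j
  show (2 ^ ((Nat.log 2 n + c) ^ c) + 1) * 2 ^ (2 * (Nat.log 2 n + c) ^ c + 6 + j) < 3 ^ (2 * (Nat.log 2 n + c) ^ c + 6 + j)
  rw [pow_add, pow_add (3 : ℕ), ← mul_assoc]
  calc (2 ^ ((Nat.log 2 n + c) ^ c) + 1) * 2 ^ (2 * (Nat.log 2 n + c) ^ c + 6) * 2 ^ j
      < 3 ^ (2 * (Nat.log 2 n + c) ^ c + 6) * 2 ^ j := Nat.mul_lt_mul_of_pos_right h1 (Nat.two_pow_pos j)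
    _ ≤ 3 ^ (2 * (Nat.log 2 n + c) ^ c + 6) * 3 ^ j := Nat.mul_le_mul_left _ h3

/-- ★ uniform conversion: a `3^k ≤ (r+1)·2^k` block with `k ≥ 2(log₂ n + c)^c + 6` live blocks gives `T c n < r` — no `n₀`, no fixed `s`. -/
theorem T_lt_of_block_uniform (c n k r : ℕ) (hk : 2 * (Nat.log 2 n + c) ^ c + 6 ≤ k) (h : 3 ^ k ≤ (r + 1) * 2 ^ k) : T c n < r := by
  have := lt_of_lt_of_le (T_succ_mul_two_pow_lt c n k hk) h
  have := Nat.lt_of_mul_lt_mul_right this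
  omega

/-- ★★★ **THE WINDOW CLOSED FROM ABOVE** (R334 (2) prover half; NINE's kernel threshold is `s = n / K(c,n)`, not `O(1)`): for EVERY `n` and
`s ≥ 1` with `s·(2(log₂ n + c)^c + 6) ≤ n`, every affine cube whose generator column supports have size `< s` is decided. -/
theorem cor_add_sparseCube_decided_window (c n s : ℕ) (hs : 0 < s) (hwin : s * (2 * (Nat.log 2 n + c) ^ c + 6) ≤ n)
    {N : ℕ} (Q₀ : Matrix (Fin n) (Fin n) ℝ) (G : Fin N → Matrix (Fin n) (Fin n) ℝ) (Vs : Fin N → Finset (Fin n))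
    (hG : ∀ t x y, G t x y ≠ 0 → y ∈ Vs t) (hVs : ∀ t, (Vs t).card < s) (r : ℕ)
    (hEF : HasEFOfSize (corPolytope n + convexHull ℝ (Set.range (cubePt Q₀ G))) r) : T c n < r := by
  have hns : s ≤ n := le_trans (Nat.le_mul_of_pos_right s (by omega)) hwin
  have hk : 2 * (Nat.log 2 n + c) ^ c + 6 ≤ n / s := (Nat.le_div_iff_mul_le hs).mpr (by rw [mul_comm]; exact hwin)
  exact T_lt_of_block_uniform c n (n / s) r hk (cor_add_sparseCube_bound (βstd_σstd hs hns) Q₀ G Vs hG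
    (fun t i => lt_of_lt_of_le (hVs t) (le_bsize_βstd hs hns i)) r hEF)

end SparseRate

/-! ### §12c′ mechanism α's engine in the LITERAL LAW-BODY currency of `exactTilted` (REV 18 ll. 2880–2923, 3161–3171, `section DeadBlocks`) -/

section DeadBlocks

variable {n k : ℕ}

/-- ★★ **MECHANISM α's ENGINE in the LITERAL LAW-BODY CURRENCY of `exactTilted`** (maxima `mm`, a nonnegative factorization of the augmented
slack of `COR + Q` through `r + 1` slots): a tilt tight on the live face + ONE point maximising every located row ⇒ `3^{k−|D|} ≤ (r+1)·2^{k−|D|}`. -/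
theorem lawBody_bound_of_commonMaxD {β : Fin n → Fin k} {σ : Fin k → Fin n} (hβσ : ∀ i, β (σ i) = i) (D : Finset (Fin k))
    {ι : Type*} (q : ι → (Fin (n * n) → ℝ)) (W : Matrix (Fin n) (Fin n) ℝ)
    (htight : ∀ S : Finset (Fin k), Disjoint S D → flat W ⬝ᵥ udPt (bUn β S) = hCOR W) (jstar : ι)
    (hmax : ∀ (a : Finset (Fin n)) (j : ι), (udRow a + flat W) ⬝ᵥ q j ≤ (udRow a + flat W) ⬝ᵥ q jstar) (r : ℕ)
    (mm : exactTilted.A n → ℝ) (hle : ∀ a j, exactTilted.ρ n a ⬝ᵥ q j ≤ mm a) (hat : ∀ a, ∃ j, exactTilted.ρ n a ⬝ᵥ q j = mm a)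
    (U : exactTilted.A n → Option (Fin r) → ℝ) (V : Finset (Fin n) × ι → Option (Fin r) → ℝ)
    (hU : ∀ a i, 0 ≤ U a i) (hV : ∀ p i, 0 ≤ V p i)
    (hfac : ∀ a b j, (exactTilted.β n a + mm a) - exactTilted.ρ n a ⬝ᵥ (udPt b + q j) = ∑ i, U a i * V (b, j) i) :
    3 ^ (k - D.card) ≤ (r + 1) * 2 ^ (k - D.card) := by
  classical
  let emb : {i : Fin k // i ∉ D} ↪ Fin k := Function.Embedding.subtype _
  let row : Finset {i : Fin k // i ∉ D} → exactTilted.A n := fun α' => ((α'.map emb).image σ, W)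
  let col : Finset {i : Fin k // i ∉ D} → Finset (Fin n) × ι := fun S => (bUn β (S.map emb), jstar)
  have hdisj : ∀ S : Finset {i : Fin k // i ∉ D}, Disjoint (S.map emb) D := by
    intro S
    rw [Finset.disjoint_left]
    rintro i hi
    obtain ⟨i', -, rfl⟩ := Finset.mem_map.mp hi
    exact i'.property
  have hmm : ∀ α', mm (row α') = (udRow ((α'.map emb).image σ) + flat W) ⬝ᵥ q jstar := by
    intro α'
    obtain ⟨j₀, hj₀⟩ := hat (row α')
    have h1 := hle (row α') jstar
    have h2 : exactTilted.ρ n (row α') ⬝ᵥ q j₀ ≤ (udRow ((α'.map emb).image σ) + flat W) ⬝ᵥ q jstar := hmax _ j₀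
    rw [hj₀] at h2
    exact le_antisymm h2 h1
  have key := three_pow_le_of_block (ι := Option (Fin r)) U (fun p => V (p.1, p.2)) hU (fun p i => hV _ i) row col ?_
  · have hc : Fintype.card {i : Fin k // i ∉ D} = k - D.card := by
      rw [Fintype.card_subtype]
      have : (Finset.univ.filter (fun i : Fin k => i ∉ D)) = Finset.univ \ D := by
        ext i; simp
      rw [this, Finset.card_univ_sdiff, Fintype.card_fin]
    rw [hc] at key
    simpa [Fintype.card_option, Fintype.card_fin] using key
  · intro α' S
    show ∑ i, U (row α') i * V (bUn β (S.map emb), jstar) i = _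
    rw [← hfac (row α') (bUn β (S.map emb)) jstar, hmm α']
    show ((1 + hCOR W) + (udRow ((α'.map emb).image σ) + flat W) ⬝ᵥ q jstar) -
        (udRow ((α'.map emb).image σ) + flat W) ⬝ᵥ (udPt (bUn β (S.map emb)) + q jstar) = (1 - ((α' ∩ S).card : ℝ)) ^ 2
    rw [dotProduct_add, add_dotProduct _ _ (udPt (bUn β (S.map emb))), htight _ (hdisj S), ← Finset.card_map emb,
      Finset.map_inter, ← ud_block_tog hβσ (α'.map emb) (S.map emb)]
    ring

/-- ★★★ **C′ IN ITS LITERAL LAW-BODY CURRENCY** for every cone-certified edge-read passenger (budget-free). -/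
theorem exactTilted_lawBody_of_edgesReadD {β : Fin n → Fin k} {σ : Fin k → Fin n} (hβσ : ∀ i, β (σ i) = i) (D : Finset (Fin k))
    {ι : Type*} [Fintype ι] [Nonempty ι] (Qm : ι → Matrix (Fin n) (Fin n) ℝ) (N : ι → Finset ι)
    (hcone : ∀ j j', ∃ c : ι → ℝ, (∀ e, 0 ≤ c e) ∧ flat (Qm j') - flat (Qm j) = ∑ e ∈ N j, c e • (flat (Qm e) - flat (Qm j)))
    (hw : ∀ j, ∀ e ∈ N j, Qm e ≠ Qm j → ∃ U, faceZeroD β D U ∧ flat U ⬝ᵥ flat (Qm e - Qm j) ≠ 0) (r : ℕ)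
    (mm : exactTilted.A n → ℝ) (hle : ∀ a j, exactTilted.ρ n a ⬝ᵥ flat (Qm j) ≤ mm a) (hat : ∀ a, ∃ j, exactTilted.ρ n a ⬝ᵥ flat (Qm j) = mm a)
    (U : exactTilted.A n → Option (Fin r) → ℝ) (V : Finset (Fin n) × ι → Option (Fin r) → ℝ) (hU : ∀ a i, 0 ≤ U a i) (hV : ∀ p i, 0 ≤ V p i)
    (hfac : ∀ a b j, (exactTilted.β n a + mm a) - exactTilted.ρ n a ⬝ᵥ (udPt b + flat (Qm j)) = ∑ i, U a i * V (b, j) i) :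
    3 ^ (k - D.card) ≤ (r + 1) * 2 ^ (k - D.card) := by
  obtain ⟨W, jstar, ht, hmax⟩ := exists_commonMax_of_edgesReadD β D Qm N hcone hw
  exact lawBody_bound_of_commonMaxD hβσ D (fun j => flat (Qm j)) W ht jstar hmax r mm hle hat U V hU hV hfac

end DeadBlocks

/-! ### §12e′ the WINDOW for sparse pairwise differences (REV 18 ll. 3270–3278, `section PairsRead`) -/

section PairsRead

variable {n k : ℕ}

/-- ★★★ the WINDOW form for SPARSE DIFFERENCES (any passenger; every `n`). -/
theorem cor_add_sparseDiff_decided_window (c n s : ℕ) (hs : 0 < s) (hwin : s * (2 * (Nat.log 2 n + c) ^ c + 6) ≤ n)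
    {ι : Type*} [Fintype ι] [Nonempty ι] (Qm : ι → Matrix (Fin n) (Fin n) ℝ) (Vs : ι → ι → Finset (Fin n))
    (hG : ∀ j j' x y, (Qm j - Qm j') x y ≠ 0 → y ∈ Vs j j') (hVs : ∀ j j', (Vs j j').card < s) (r : ℕ)
    (hEF : HasEFOfSize (corPolytope n + convexHull ℝ (Set.range (fun j => flat (Qm j)))) r) : T c n < r := by
  have hns : s ≤ n := le_trans (Nat.le_mul_of_pos_right s (by omega)) hwin
  have hk : 2 * (Nat.log 2 n + c) ^ c + 6 ≤ n / s := (Nat.le_div_iff_mul_le hs).mpr (by rw [mul_comm]; exact hwin)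
  exact T_lt_of_block_uniform c n (n / s) r hk (cor_add_sparseDiff_bound (βstd_σstd hs hns) Qm Vs hG
    (fun j j' i => lt_of_lt_of_le (hVs j j') (le_bsize_βstd hs hns i)) r hEF)

end PairsRead

/-! ### §12h′ C′ law body on FUNCTION-GRAPH passengers (REV 18 ll. 3467–3483, `section FuncGraph`) -/

section FuncGraph

variable {n k : ℕ}

/-- ★★★ **`exactTilted.Law` RESTRICTED TO FUNCTION-GRAPH PASSENGERS HOLDS** — C′ in its literal currency (the budget hypothesis is not used). -/
theorem exactTilted_lawBody_funcGraph (c : ℕ) : ∃ n₀ : ℕ, ∀ n ≥ n₀, ∀ (K : ℕ) (M : Fin (K + 1) → (Fin n → Fin n)) (r : ℕ),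
    HasEFOfSize (convexHull ℝ (Set.range (fun j => flat (graphMat (M j))))) r →
    ∀ mm : exactTilted.A n → ℝ, (∀ a j, exactTilted.ρ n a ⬝ᵥ flat (graphMat (M j)) ≤ mm a) →
      (∀ a, ∃ j, exactTilted.ρ n a ⬝ᵥ flat (graphMat (M j)) = mm a) →
    ∀ (U : exactTilted.A n → Option (Fin r) → ℝ) (V : Finset (Fin n) × Fin (K + 1) → Option (Fin r) → ℝ),
      (∀ a i, 0 ≤ U a i) → (∀ p i, 0 ≤ V p i) →
      (∀ a b j, (exactTilted.β n a + mm a) - exactTilted.ρ n a ⬝ᵥ (udPt b + flat (graphMat (M j))) = ∑ i, U a i * V (b, j) i) →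
      T c n < r := by
  obtain ⟨n₀, hn₀⟩ := T_lt_of_block_div 2 (by norm_num) c
  refine ⟨max n₀ 2, fun n hn K M r _ mm hle hat U V hU hV hfac => hn₀ n (le_of_max_le_left hn) r ?_⟩
  have hns : 2 ≤ n := le_of_max_le_right hn
  obtain ⟨W, jstar, ht, hmax⟩ := exists_commonMax_of_pairsRead (βstd (by norm_num) hns) (fun j => graphMat (M j))
    (fun _ _ hne => exists_faceZero_reads_graphMat _ (le_bsize_βstd (by norm_num) hns) hne)
  have := lawBody_bound_of_commonMaxD (βstd_σstd (by norm_num) hns) ∅ (fun j => flat (graphMat (M j))) W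
    (fun S _ => ht S) jstar hmax r mm hle hat U V hU hV hfac
  simpa using this

end FuncGraph

end Summit.ValiantsHypothesis.ValiantsHypothesis.Theorems.FifoMatching.ExactPencil
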